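import Summits.PneNP.PneNP.Theorems.ChebyshevTracialDesignMonomialVirtualValue
import Summits.PneNP.PneNP.Theorems.ChebyshevTracialDesignDesignLevelPolyAssembly
import Summits.PneNP.PneNP.Theorems.ChebyshevTracialDesignJuntaLowDegree
import HarnessLib

/-!
# Cell pnp-psdrank, route `ChebyshevTracialDesign`: LOW-DEGREE MATCHING-SIDE FACTORS — an exact design prices `X ⊗ B Bᵀ`
# (cut side ARBITRARY psd, matching side of degree `≤ k`, `2k ≤ D`) at MINUS the averaged Grigoriev ⊗ Grigoriev virtual form,
# hence `≤ 0` whenever that pseudo-matching form is positive semidefinite (crux `TracialDecayExp20`, stmt-PneNP-19878; eng g13, MEMO-13 §4)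

The matching-side twin of `…JuntaLowDegree.sum_levelWeight_trace_nonpos_of_lowDegree` (cut-side factors of Johnson degree `≤ k`, matching
side arbitrary; priced by Grigoriev's KNAPSACK pseudo-expectation, PSD by the tree's `Grigoriev2001_knapsackFormNonneg_holds`). Here the
CUT side is an arbitrary psd family `X : OddSet n → Sym_r⁺` and the MATCHING side is a Gram family `Y_M = B_M B_Mᵀ` whose entries are
combinations of the monomials `x_F(M) = 1[F ⊆ M]`, `|F| ≤ k` (`Literature.Combinatorics.Optimization.IsLowDegreeM`) — a class containing the
edge-additive pure states of bricks A/B (`k = 1`) and the 'star dictionaries' of MEMO-13 §3 with a fixed linear label rule (`k = 3`), but no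
junta (the windows of the monomials cover all of `[n]`).
* (generic assembly, brick `…DesignLevelPolyAssembly.design_value_eq_neg_avg_virtual`: per-cut level polynomials of degree `≤ D` price any
  kernel at `−(#t-cuts)⁻¹·Σ_{|U|=t} P_U(0)`.)
* §1 **`lowdegM_sum_law`** — for `K(U,M) = tr(X_U B_M B_Mᵀ)` with `B_M(a,j) = Σ_{|F|≤k} β(a,j,F)·1[F ⊆ M]`: per cut, the SOS step
  `tr(X B Bᵀ) = Σ_{j,l} (Σ_F γ_{lj}(F)·x_F)²` (`γ = √X_U·β`) and the single-monomial level law with explicit virtual value (brick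
  `…MonomialVirtualValue.card_superset_level_eq_poly`) give `P_U` of degree `≤ 2k` with
  `P_U(0) = Σ_{j,l} Σ_{F,F'} γ_{lj}(F)γ_{lj}(F')·μ_U(F ∪ F')`, `μ_U(G)` = the Grigoriev ⊗ Grigoriev PSEUDO-MATCHING MOMENT of `G` around `U`
  (`[G extends to a perfect matching]·[no edge of G crosses U]·∏_{j<z}(t−1−2j)⁻¹·∏_{j<e}(n−t−1−2j)⁻¹`, `z`/`e` = edges of `G` inside `U`/`Ū`;
  Potechin's story values `Ẽ[x_G] = ∏_{j<|G|}(m−1−2j)⁻¹` on `K_t` and `K_{n−t}` [cite: Potechin2019, Example 3.4 and Cor. 3.10 (LIPIcs 124,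
  61:7–61:9)]).
* §2 **`sum_levelWeight_trace_nonpos_of_lowDegreeM`** — hence, for an exact design of degree `D ≥ 2k` on the `t`-cuts, `IsLowDegreeM n k B` and
  ARBITRARY psd `X`: `Σ_U Σ_M levelWeight(U,M)·tr(X_U B_M B_Mᵀ) ≤ 0` PROVIDED the quadratic form `γ ↦ Σ_{F,F'} γ_F γ_{F'} μ_U(F ∪ F')` on
  coefficient vectors indexed by `{F : |F| ≤ k}` is nonnegative for every `t`-cut `U` (hypothesis `hPSD`). That form is the restriction of
  `Ẽ_{K_t} ⊗ Ẽ_{K_{n−t}}` to degree `≤ k`, positive semidefinite for `4k + 1 ≤ min(t, n−t)` by Potechin's Theorem 1.2 ("degree (m−1)/2 SOS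
  fails to refute the MOD 2 principle", via these story values) [cite: Potechin2019, Thm. 1.2 (61:4)] and Grigoriev's linear degree bound
  [cite: Grigoriev2001TCS, Cor. 2 (p. 622)] — the discharge (Potechin's §4–5 for one odd clique + the Kronecker step) is recorded as the
  cell's typing ask, exactly as `Grigoriev2001_knapsackFormNonneg` was for the cut side.
No tightness, no variation bound, no dimension restriction. Stature: support/instrument (no defs, axioms standard; §2 CONDITIONAL on `hPSD`).
WHAT THIS IS NOT: nothing on the dense cell of the crux, nothing on psd rank, no P-vs-NP content. Supports stmt-PneNP-19878.
-/

set_option linter.dupNamespace false -- `Summit.PneNP.PneNP.…`: summit = sub-problem (D-0017)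

noncomputable section

namespace Summit.PneNP.PneNP.Theorems.ChebyshevTracialDesignLowDegreeMatchingSide

open Finset Matrix Polynomial Literature.Barriers.PneNP Literature.Combinatorics.Optimization
open Summit.PneNP.PneNP.Theorems.ChebyshevTracialDesignJunta
open Summit.PneNP.PneNP.Theorems.ChebyshevTracialDesignMonomialVirtualValue
open Summit.PneNP.PneNP.Theorems.ChebyshevTracialDesignDesignLevelPolyAssembly
open scoped MatrixOrder

variable {n : ℕ}

/-! ### §1 The per-cut polynomial of a low-degree matching side against an arbitrary psd cut operator -/

/-- Product of two containment monomials: `x_F · x_{F'} = x_{F ∪ F'}`. [folklore] -/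
theorem ite_subset_mul_ite_subset' (F F' M : Finset (Sym2 (Fin n))) :
    (if F ⊆ M then (1 : ℝ) else 0) * (if F' ⊆ M then (1 : ℝ) else 0) = if F ∪ F' ⊆ M then 1 else 0 := by
  by_cases h1 : F ⊆ M <;> by_cases h2 : F' ⊆ M <;> simp [h1, h2, union_subset_iff]

/-- `tr(X · B Bᵀ) = Σ_{j,l} (Σ_a S_{la} B_{aj})²` for a Gram representation `X(b,a) = Σ_l S_{la} S_{lb}` — the SOS step. [folklore] -/
theorem trace_mul_gram_eq_sum_sq {r m : ℕ} (X : Matrix (Fin r) (Fin r) ℝ) (S : Matrix (Fin r) (Fin r) ℝ)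
    (hS : ∀ a b, X b a = ∑ l, S l a * S l b) (B : Matrix (Fin r) (Fin m) ℝ) :
    (X * (B * Bᵀ)).trace = ∑ j, ∑ l, (∑ a, S l a * B a j) ^ 2 := by
  rw [Matrix.trace_mul_comm, trace_mul_transpose_mul_eq]
  refine sum_congr rfl fun j _ => ?_
  calc ∑ a, ∑ b, X b a * (B a j * B b j)
      = ∑ a, ∑ b, ∑ l, (S l a * B a j) * (S l b * B b j) := by
        refine sum_congr rfl fun a _ => sum_congr rfl fun b _ => ?_
        rw [hS a b, sum_mul]
        exact sum_congr rfl fun l _ => by ring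
    _ = ∑ a, ∑ l, ∑ b, (S l a * B a j) * (S l b * B b j) := sum_congr rfl fun a _ => Finset.sum_comm
    _ = ∑ l, ∑ a, ∑ b, (S l a * B a j) * (S l b * B b j) := Finset.sum_comm
    _ = ∑ l, (∑ a, S l a * B a j) ^ 2 := by
        refine sum_congr rfl fun l _ => ?_
        rw [sq, Finset.sum_mul_sum]

/-- **LOW-DEGREE SUM LAW, MATCHING SIDE.** Fix a `t`-cut `U` of `K_n` (`s = n − t`), a psd `X` with Gram factor `S`, and a matching-side
factor `B_M(a,j) = Σ_{|F| ≤ k} β(a,j,F)·1[F ⊆ M]`. Let `μ(G)` be the virtual value of the monomial `x_G` around `U` — the value exported by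
`card_superset_level_eq_poly` when some perfect matching contains `G`, and `0` otherwise (hypothesis `hμ`, the closed form written once). Then
the level sums of `tr(X B_M B_Mᵀ)` over `{M : cc(U,M) = c}` are `#{M : cc = c}·P(c)` for a polynomial `P` of degree `≤ 2k` with
`P(0) = Σ_{j,l} Σ_{F,F'} γ_{lj}(F)γ_{lj}(F')·μ(F ∪ F')`, `γ_{lj}(F) = Σ_a S_{la}β(a,j,F)`.
[cite: Potechin2019, Example 3.4 and Cor. 3.10 (LIPIcs 124, 61:7–61:9)] [cite: Rothvoss2017, §2 (PDF p. 6)] -/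
theorem lowdegM_sum_law (U : OddSet n) {t k r m : ℕ} (hUt : U.1.card = t)
    (X : Matrix (Fin r) (Fin r) ℝ) (S : Matrix (Fin r) (Fin r) ℝ) (hS : ∀ a b, X b a = ∑ l, S l a * S l b)
    (β : Fin r → Fin m → {F : Finset (Sym2 (Fin n)) // F.card ≤ k} → ℝ)
    (μ : Finset (Sym2 (Fin n)) → ℝ)
    (hμ : ∀ G : Finset (Sym2 (Fin n)), μ G =
      if ((univ : Finset (PMatch n)).filter fun M => G ⊆ M.1).Nonempty then
        (if (G.filter fun e => cutCount U.1 e = 1).card = 0 then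
          (∏ j ∈ range (G.filter fun e => cutCount U.1 e = 2).card, ((t : ℝ) - 1 - 2 * j))⁻¹ *
          (∏ j ∈ range (G.card - (G.filter fun e => cutCount U.1 e = 1).card - (G.filter fun e => cutCount U.1 e = 2).card),
            (((n - t : ℕ) : ℝ) - 1 - 2 * j))⁻¹ else 0)
      else 0) :
    ∃ P : Polynomial ℝ, P.natDegree ≤ 2 * k ∧
      P.eval 0 = ∑ j : Fin m, ∑ l : Fin r, ∑ F : {F : Finset (Sym2 (Fin n)) // F.card ≤ k},
        ∑ F' : {F : Finset (Sym2 (Fin n)) // F.card ≤ k},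
          (∑ a, S l a * β a j F) * (∑ a, S l a * β a j F') * μ (F.1 ∪ F'.1) ∧
      ∀ c i i' : ℕ, c + 2 * i = t → c + 2 * i' = n - t →
        ∑ M : PMatch n, (if U.1.card = t ∧ cc U M = c then
          (X * ((Matrix.of fun a j => ∑ F : {F : Finset (Sym2 (Fin n)) // F.card ≤ k},
              β a j F * (if F.1 ⊆ M.1 then (1 : ℝ) else 0)) *
            (Matrix.of fun a j => ∑ F : {F : Finset (Sym2 (Fin n)) // F.card ≤ k},
              β a j F * (if F.1 ⊆ M.1 then (1 : ℝ) else 0))ᵀ)).trace else 0) =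
        ((((perfectMatchings (univ : Finset (Fin n))).filter fun M' =>
            (M'.filter fun e => cutCount U.1 e = 1).card = c).card : ℕ) : ℝ) * P.eval (c : ℝ) := by
  classical
  have hcardc : ((univ : Finset (Fin n)) \ U.1).card = n - t := by
    rw [card_sdiff_of_subset (subset_univ _), card_univ, Fintype.card_fin, hUt]
  -- the polynomial of each monomial `x_G`, with its virtual value `μ G`
  have hPG : ∀ G : Finset (Sym2 (Fin n)), ∃ P : Polynomial ℝ, P.natDegree ≤ G.card ∧ P.eval 0 = μ G ∧
      ∀ c i i' : ℕ, c + 2 * i = t → c + 2 * i' = n - t →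
        ((((perfectMatchings (univ : Finset (Fin n))).filter fun M' =>
            G ⊆ M' ∧ (M'.filter fun e => cutCount U.1 e = 1).card = c).card : ℕ) : ℝ) =
          ((((perfectMatchings (univ : Finset (Fin n))).filter fun M' =>
              (M'.filter fun e => cutCount U.1 e = 1).card = c).card : ℕ) : ℝ) * P.eval (c : ℝ) := by
    intro G
    by_cases hG : ((univ : Finset (PMatch n)).filter fun M => G ⊆ M.1).Nonempty
    · obtain ⟨M₀, hM₀⟩ := id hG
      have hGM₀ : G ⊆ M₀.1 := (mem_filter.1 hM₀).2
      have hW := isPMOn_verts_of_subset (mem_perfectMatchings.2 M₀.2) hGM₀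
      obtain ⟨P, hPdeg, hP0, hPval⟩ := card_superset_level_eq_poly (subset_univ U.1) (filter_subset _ _) hW hUt hcardc
      refine ⟨P, hPdeg, ?_, hPval⟩
      rw [hP0, hμ G, if_pos hG]
    · refine ⟨0, by simp, ?_, fun c i i' _ _ => ?_⟩
      · rw [hμ G, if_neg hG, eval_zero]
      · have hnone : ∀ M' ∈ perfectMatchings (univ : Finset (Fin n)), ¬ G ⊆ M' := by
          intro M' hM' hGM'
          exact hG ⟨⟨M', mem_perfectMatchings.1 hM'⟩, mem_filter.2 ⟨mem_univ _, hGM'⟩⟩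
        rw [card_superset_level_eq_zero hnone, eval_zero, Nat.cast_zero, mul_zero]
  choose P hPdeg hP0 hPval using hPG
  -- the coefficients `γ_{lj}(F) γ_{lj}(F')`
  set γ : Fin r → Fin m → {F : Finset (Sym2 (Fin n)) // F.card ≤ k} → ℝ := fun l j F => ∑ a, S l a * β a j F with hγ
  refine ⟨∑ j : Fin m, ∑ l : Fin r, ∑ F : {F : Finset (Sym2 (Fin n)) // F.card ≤ k},
      ∑ F' : {F : Finset (Sym2 (Fin n)) // F.card ≤ k}, C (γ l j F * γ l j F') * P (F.1 ∪ F'.1), ?_, ?_, ?_⟩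
  · -- degree ≤ 2k
    refine natDegree_sum_le_of_forall_le _ _ fun j _ => natDegree_sum_le_of_forall_le _ _ fun l _ =>
      natDegree_sum_le_of_forall_le _ _ fun F _ => natDegree_sum_le_of_forall_le _ _ fun F' _ => ?_
    refine (natDegree_C_mul_le _ _).trans ((hPdeg _).trans ?_)
    exact (card_union_le _ _).trans (by have := F.2; have := F'.2; omega)
  · -- the virtual value
    simp only [eval_finsetSum, eval_mul, eval_C, hP0, hγ]
  · -- the level sums
    intro c i i' hci hci'
    -- expand the kernel as a combination of monomials `x_{F ∪ F'}`
    have hK : ∀ M : PMatch n,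
        (X * ((Matrix.of fun a j => ∑ F : {F : Finset (Sym2 (Fin n)) // F.card ≤ k},
            β a j F * (if F.1 ⊆ M.1 then (1 : ℝ) else 0)) *
          (Matrix.of fun a j => ∑ F : {F : Finset (Sym2 (Fin n)) // F.card ≤ k},
            β a j F * (if F.1 ⊆ M.1 then (1 : ℝ) else 0))ᵀ)).trace =
        ∑ j : Fin m, ∑ l : Fin r, ∑ F : {F : Finset (Sym2 (Fin n)) // F.card ≤ k},
          ∑ F' : {F : Finset (Sym2 (Fin n)) // F.card ≤ k},
            γ l j F * γ l j F' * (if F.1 ∪ F'.1 ⊆ M.1 then (1 : ℝ) else 0) := by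
      intro M
      rw [trace_mul_gram_eq_sum_sq X S hS]
      refine sum_congr rfl fun j _ => sum_congr rfl fun l _ => ?_
      have hlin : ∑ a, S l a * (Matrix.of fun a j => ∑ F : {F : Finset (Sym2 (Fin n)) // F.card ≤ k},
          β a j F * (if F.1 ⊆ M.1 then (1 : ℝ) else 0)) a j =
          ∑ F : {F : Finset (Sym2 (Fin n)) // F.card ≤ k}, γ l j F * (if F.1 ⊆ M.1 then (1 : ℝ) else 0) := by
        simp only [Matrix.of_apply, mul_sum]
        rw [Finset.sum_comm]
        refine sum_congr rfl fun F _ => ?_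
        rw [hγ, sum_mul]
        exact sum_congr rfl fun a _ => by ring
      rw [hlin, sq, Finset.sum_mul_sum]
      refine sum_congr rfl fun F _ => sum_congr rfl fun F' _ => ?_
      rw [← ite_subset_mul_ite_subset']
      ring
    simp_rw [hK]
    rw [sum_pmatch_level_eq' U hUt]
    -- exchange the sums and use the monomial level law
    have hswap : ∑ M' ∈ (perfectMatchings (univ : Finset (Fin n))).filter
          (fun M' => (M'.filter fun e => cutCount U.1 e = 1).card = c),
        (if h : IsPMOn (univ : Finset (Fin n)) M' then
          ∑ j : Fin m, ∑ l : Fin r, ∑ F : {F : Finset (Sym2 (Fin n)) // F.card ≤ k},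
            ∑ F' : {F : Finset (Sym2 (Fin n)) // F.card ≤ k},
              γ l j F * γ l j F' * (if F.1 ∪ F'.1 ⊆ (⟨M', h⟩ : PMatch n).1 then (1 : ℝ) else 0) else 0) =
        ∑ j : Fin m, ∑ l : Fin r, ∑ F : {F : Finset (Sym2 (Fin n)) // F.card ≤ k},
          ∑ F' : {F : Finset (Sym2 (Fin n)) // F.card ≤ k}, γ l j F * γ l j F' *
            ((((perfectMatchings (univ : Finset (Fin n))).filter fun M' =>
              F.1 ∪ F'.1 ⊆ M' ∧ (M'.filter fun e => cutCount U.1 e = 1).card = c).card : ℕ) : ℝ) := by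
      have hin : ∀ M' ∈ (perfectMatchings (univ : Finset (Fin n))).filter
          (fun M' => (M'.filter fun e => cutCount U.1 e = 1).card = c),
          (if h : IsPMOn (univ : Finset (Fin n)) M' then
            ∑ j : Fin m, ∑ l : Fin r, ∑ F : {F : Finset (Sym2 (Fin n)) // F.card ≤ k},
              ∑ F' : {F : Finset (Sym2 (Fin n)) // F.card ≤ k},
                γ l j F * γ l j F' * (if F.1 ∪ F'.1 ⊆ (⟨M', h⟩ : PMatch n).1 then (1 : ℝ) else 0) else 0) =
          ∑ j : Fin m, ∑ l : Fin r, ∑ F : {F : Finset (Sym2 (Fin n)) // F.card ≤ k},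
            ∑ F' : {F : Finset (Sym2 (Fin n)) // F.card ≤ k},
              γ l j F * γ l j F' * (if F.1 ∪ F'.1 ⊆ M' then (1 : ℝ) else 0) := by
        intro M' hM'
        rw [dif_pos (mem_perfectMatchings.1 (mem_filter.1 hM').1)]
      rw [sum_congr rfl hin, sum_comm]
      refine sum_congr rfl fun j _ => ?_
      rw [sum_comm]
      refine sum_congr rfl fun l _ => ?_
      rw [sum_comm]
      refine sum_congr rfl fun F _ => ?_
      rw [sum_comm]
      refine sum_congr rfl fun F' _ => ?_
      rw [← mul_sum, card_filter, Nat.cast_sum]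
      congr 1
      rw [sum_filter]
      refine sum_congr rfl fun M' _ => ?_
      by_cases h1 : F.1 ∪ F'.1 ⊆ M' <;> by_cases h2 : (M'.filter fun e => cutCount U.1 e = 1).card = c <;> simp [h1, h2]
    rw [hswap, eval_finsetSum, mul_sum]
    refine sum_congr rfl fun j _ => ?_
    rw [eval_finsetSum, mul_sum]
    refine sum_congr rfl fun l _ => ?_
    rw [eval_finsetSum, mul_sum]
    refine sum_congr rfl fun F _ => ?_
    rw [eval_finsetSum, mul_sum]
    refine sum_congr rfl fun F' _ => ?_
    rw [hPval (F.1 ∪ F'.1) c i i' hci hci', eval_mul, eval_C]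
    ring

/-! ### §2 Nonpositivity of the design value, given positive semidefiniteness of the pseudo-matching form -/

/-- **LOW-DEGREE MATCHING-SIDE FACTORS ARE PRICED `≤ 0`, given the pseudo-matching PSD form.** Let `(C, w)` be an exact design of degree `D`
on the `t`-cuts of `K_n`, `X : OddSet n → Sym_r⁺` ANY psd family, and `B : PMatch n → ℝ^{r×m}` of matching-degree `≤ k`
(`IsLowDegreeM n k B`) with `2k ≤ D`. Suppose that for every `t`-cut `U` the Grigoriev ⊗ Grigoriev virtual form
`γ ↦ Σ_{F,F'} γ_F γ_{F'} μ_U(F ∪ F')` on coefficient vectors indexed by `{F : |F| ≤ k}` is nonnegative (`hPSD`; `μ_U` in closed form as in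
`lowdegM_sum_law` — Potechin's story pseudo-expectations of `K_t` and `K_{n−t}`, PSD for `4k + 1 ≤ min(t, n − t)`
[cite: Potechin2019, Thm. 1.2 and Cor. 3.10 (LIPIcs 124, 61:4, 61:9)]). Then `Σ_U Σ_M levelWeight(U,M)·tr(X_U B_M B_Mᵀ) ≤ 0` — in every
dimension, with no tightness and no hypothesis on the cut side. [cite: Rothvoss2017, §2 (PDF p. 6)] [cite: Grigoriev2001TCS, Cor. 2 (p. 622)] -/
theorem sum_levelWeight_trace_nonpos_of_lowDegreeM {t T D : ℕ} {Bv : ℝ} {C : Finset ℕ} {w : ℕ → ℝ}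
    (hdes : IsExactDesign n t T D Bv C w) {r m k : ℕ} (h2k : 2 * k ≤ D)
    (X : OddSet n → Matrix (Fin r) (Fin r) ℝ) (hX : ∀ U, (X U).PosSemidef)
    (B : PMatch n → Matrix (Fin r) (Fin m) ℝ) (hB : IsLowDegreeM n k B)
    (hPSD : ∀ U : OddSet n, U.1.card = t → ∀ γ : {F : Finset (Sym2 (Fin n)) // F.card ≤ k} → ℝ,
      0 ≤ ∑ F, ∑ F', γ F * γ F' *
        (if ((univ : Finset (PMatch n)).filter fun M => F.1 ∪ F'.1 ⊆ M.1).Nonempty then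
          (if ((F.1 ∪ F'.1).filter fun e => cutCount U.1 e = 1).card = 0 then
            (∏ j ∈ range ((F.1 ∪ F'.1).filter fun e => cutCount U.1 e = 2).card, ((t : ℝ) - 1 - 2 * j))⁻¹ *
            (∏ j ∈ range ((F.1 ∪ F'.1).card - ((F.1 ∪ F'.1).filter fun e => cutCount U.1 e = 1).card -
                ((F.1 ∪ F'.1).filter fun e => cutCount U.1 e = 2).card), (((n - t : ℕ) : ℝ) - 1 - 2 * j))⁻¹ else 0)
        else 0)) :
    ∑ U, ∑ M, levelWeight n t C w U M * (X U * (B M * (B M)ᵀ)).trace ≤ 0 := by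
  classical
  -- coefficients of the low-degree entries
  have hβ' : ∀ a j, ∃ c : {F : Finset (Sym2 (Fin n)) // F.card ≤ k} → ℝ,
      ∑ F, c F • (fun M : PMatch n => if F.1 ⊆ M.1 then (1 : ℝ) else 0) = fun M => B M a j :=
    fun a j => (Submodule.mem_span_range_iff_exists_fun ℝ).1 (hB a j)
  choose β hβ using hβ'
  have hBeval : ∀ M : PMatch n, B M = Matrix.of fun a j =>
      ∑ F : {F : Finset (Sym2 (Fin n)) // F.card ≤ k}, β a j F * (if F.1 ⊆ M.1 then (1 : ℝ) else 0) := by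
    intro M
    ext a j
    have := congrFun (hβ a j) M
    rw [Finset.sum_apply] at this
    rw [Matrix.of_apply, ← this]
    exact sum_congr rfl fun F _ => by rw [Pi.smul_apply, smul_eq_mul]
  -- Gram factors of the cut operators
  have hS' : ∀ U : OddSet n, ∃ S : Matrix (Fin r) (Fin r) ℝ, ∀ a b, X U b a = ∑ l, S l a * S l b :=
    fun U => exists_gram_of_posSemidef (hX U)
  choose S hS using hS'
  -- the virtual form around each cut, written once
  set μ : OddSet n → Finset (Sym2 (Fin n)) → ℝ := fun U G =>
    if ((univ : Finset (PMatch n)).filter fun M => G ⊆ M.1).Nonempty then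
      (if (G.filter fun e => cutCount U.1 e = 1).card = 0 then
        (∏ j ∈ range (G.filter fun e => cutCount U.1 e = 2).card, ((U.1.card : ℝ) - 1 - 2 * j))⁻¹ *
        (∏ j ∈ range (G.card - (G.filter fun e => cutCount U.1 e = 1).card - (G.filter fun e => cutCount U.1 e = 2).card),
          (((n - U.1.card : ℕ) : ℝ) - 1 - 2 * j))⁻¹ else 0)
    else 0 with hμdef
  -- per-cut polynomials
  have hP : ∀ U : OddSet n, ∃ P : Polynomial ℝ, P.natDegree ≤ D ∧ 0 ≤ P.eval 0 ∧ (U.1.card ≠ t → P = 0) ∧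
      (U.1.card = t → ∀ c i i' : ℕ, c + 2 * i = t → c + 2 * i' = n - t →
        ∑ M : PMatch n, (if U.1.card = t ∧ cc U M = c then (X U * (B M * (B M)ᵀ)).trace else 0) =
          ((((perfectMatchings (univ : Finset (Fin n))).filter fun M' =>
              (M'.filter fun e => cutCount U.1 e = 1).card = c).card : ℕ) : ℝ) * P.eval (c : ℝ)) := by
    intro U
    by_cases hUt : U.1.card = t
    · obtain ⟨P, hPdeg, hP0, hPval⟩ := lowdegM_sum_law U hUt (X U) (S U) (hS U) β (μ U)
        (fun G => by simp only [hμdef, hUt])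
      refine ⟨P, hPdeg.trans h2k, ?_, fun h => absurd hUt h, fun _ c i i' hci hci' => ?_⟩
      · rw [hP0]
        refine sum_nonneg fun j _ => sum_nonneg fun l _ => ?_
        have h := hPSD U hUt (fun F => ∑ a, S U l a * β a j F)
        refine le_of_le_of_eq h (sum_congr rfl fun F _ => sum_congr rfl fun F' _ => ?_)
        simp only [hμdef, hUt]
      · rw [← hPval c i i' hci hci']
        refine Fintype.sum_congr _ _ fun M => ?_
        rw [hBeval M]
    · exact ⟨0, by simp, by simp, fun _ => rfl, fun h => absurd h hUt⟩
  choose P hPdeg hP0 hPzero hPval using hP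
  rw [design_value_eq_neg_avg_virtual hdes (fun U M => (X U * (B M * (B M)ᵀ)).trace) P hPdeg hPzero hPval]
  rw [neg_nonpos]
  exact mul_nonneg (inv_nonneg.2 (sum_nonneg fun U _ => by split_ifs <;> norm_num)) (sum_nonneg fun U _ => hP0 U)

end Summit.PneNP.PneNP.Theorems.ChebyshevTracialDesignLowDegreeMatchingSide
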